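import Mathlib
import HarnessLib
import Summits.ResolutionOfSingularities.ResolutionOfSingularities.Theorems.WildQuotientsWildQuotientResolutionToricExitCentre
import Summits.ResolutionOfSingularities.ResolutionOfSingularities.Theorems.WildQuotientsWildQuotientResolutionBlowupChartRegularPiece
import Summits.ResolutionOfSingularities.ResolutionOfSingularities.Theorems.WildQuotientsWildQuotientResolutionBlowupLocalExit
import Literature.AlgebraicGeometry.Resolution.BlowupPrincipalCharts
import Literature.AlgebraicGeometry.Resolution.AffineBlowupAlgebra

/-!
# V3U-F brick `Hregb`: the points of the principal chart `V[x_b²]` of `Bl_{(x_a, x_b²)} 𝔸ⁿ` have regular stalks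
(crux stmt-ResolutionOfSingularities-15640 `WildQuotients.WildQuotientResolution`, line `Sketch`;
chain w45c programme V3U, `L/w45c/CHAIN.md` v6 §4 lead-1 row — the brick `Hregb` of
res-L1-w45c-lead-1's `ToricExit.jordanThree_hasResolution_of_bricks` (p496627), discharged by
res-D-pv-033 AS res-L1-w45c-stub-5; [OURS · L1 W4.5c] — NOT a statement of any manuscript.)

* `BlowupExit.exists_blowupAlgebra_ringEquiv_of_ringEquiv` — **transport of the affine blowup
  algebra along a ring isomorphism**: `e : R ≃+* R'` induces `R[I/a] ≃+* R'[e(I)/e(a)]` over `e`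
  (through `R[1/a] ≃+* R'[1/e(a)]`, `IsLocalization.ringEquivOfRingEquiv`); hence
  `BlowupExit.isRegularRing_blowupAlgebra_map_of_ringEquiv`.
* `ToricExit.isRegularRing_blowupAlgebra_idealSheaf_centre_b` — the affine blowup algebra
  `Γ(𝔸ⁿ, ⊤)[Ĩ₂(⊤)/x_b²]` of the Literature chart `V[⊤, x_b²]` is a regular ring: stub-2's D2
  `ToricExit.isRegularRing_chartRing_centre_b` (p485686; the Rees chart ring `(k[x][I₂t])_{(x_b²t)}`)
  moved along `reesChartEquiv` (Stacks 07Z3 (3)) and along `Γ(Spec k[x], ⊤) ≅ k[x]` (`ΓSpecIso`).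
* `ToricExit.isRegularLocalRing_stalk_of_mem_blowupChart_centre_b` — VERBATIM the hypothesis
  `Hregb` of p496627: every point of `V[⊤, x_b²]` has a regular local ring (stub-3's
  `BlowupExit.isRegular_blowupChart_of_isRegularRing`, p492566, + `isRegularLocalRing_stalk_of_mem`).
-/

-- single-problem summit: the doubled namespace component `ResolutionOfSingularities` is forced
set_option linter.dupNamespace false

noncomputable section

open CategoryTheory AlgebraicGeometry TopologicalSpace MvPolynomial HomogeneousLocalization
open Literature.AlgebraicGeometry.Resolution

namespace Summit.ResolutionOfSingularities.ResolutionOfSingularities.Theorems.WildQuotientResolution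

namespace BlowupExit

universe u

variable {R R' : Type u} [CommRing R] [CommRing R']

/-- **The affine blowup algebra is transported along ring isomorphisms**: for `e : R ≃+* R'`,
an ideal `I ⊆ R` and `a ∈ R` there is a ring isomorphism `R[I/a] ≃+* R'[e(I)/e(a)]` compatible
with the structure maps (restriction of `R[1/a] ≃+* R'[1/e(a)]`). [folklore] -/
theorem exists_blowupAlgebra_ringEquiv_of_ringEquiv (e : R ≃+* R') (I : Ideal R) (a : R) :
    ∃ F : blowupAlgebra I a ≃+* blowupAlgebra (I.map (e : R →+* R')) (e a),
      ∀ r : R, F (algebraMap R (blowupAlgebra I a) r) =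
        algebraMap R' (blowupAlgebra (I.map (e : R →+* R')) (e a)) (e r) := by
  have H : (Submonoid.powers a).map (e : R ≃+* R').toMonoidHom = Submonoid.powers (e a) :=
    Submonoid.map_powers _ a
  let E : Localization.Away a ≃+* Localization.Away (e a) :=
    IsLocalization.ringEquivOfRingEquiv (Localization.Away a) (Localization.Away (e a)) e H
  have hE : ∀ r : R, E (algebraMap R (Localization.Away a) r) =
      algebraMap R' (Localization.Away (e a)) (e r) := fun r =>
    IsLocalization.ringEquivOfRingEquiv_eq H r
  have hEsymm : ∀ r' : R', E.symm (algebraMap R' (Localization.Away (e a)) r') =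
      algebraMap R (Localization.Away a) (e.symm r') := fun r' => by
    apply E.injective
    rw [E.apply_symm_apply, hE, e.apply_symm_apply]
  have hEinv : E (IsLocalization.Away.invSelf a) = IsLocalization.Away.invSelf (e a) := by
    have h1 : algebraMap R' (Localization.Away (e a)) (e a) * E (IsLocalization.Away.invSelf a) = 1 := by
      rw [← hE, ← map_mul, IsLocalization.Away.mul_invSelf, map_one]
    have h2 : algebraMap R' (Localization.Away (e a)) (e a) *
        IsLocalization.Away.invSelf (e a) = 1 := IsLocalization.Away.mul_invSelf (e a)
    calc E (IsLocalization.Away.invSelf a)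
        = (IsLocalization.Away.invSelf (e a) * algebraMap R' (Localization.Away (e a)) (e a)) *
            E (IsLocalization.Away.invSelf a) := by rw [mul_comm (IsLocalization.Away.invSelf _), h2, one_mul]
      _ = IsLocalization.Away.invSelf (e a) * (algebraMap R' (Localization.Away (e a)) (e a) *
            E (IsLocalization.Away.invSelf a)) := mul_assoc _ _ _
      _ = IsLocalization.Away.invSelf (e a) := by rw [h1, mul_one]
  have hEinv' : E.symm (IsLocalization.Away.invSelf (e a)) = IsLocalization.Away.invSelf a := by
    rw [← hEinv, E.symm_apply_apply]
  -- `E` maps `R[I/a]` into `R'[e(I)/e(a)]`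
  have hfwd : ∀ x ∈ blowupAlgebra I a, E x ∈ blowupAlgebra (I.map (e : R →+* R')) (e a) := by
    intro x hx
    refine Algebra.adjoin_induction (fun y hy => ?_) (fun r => ?_) (fun y z _ _ hy hz => ?_)
      (fun y z _ _ hy hz => ?_) hx
    · obtain ⟨x₀, hx₀, rfl⟩ := hy
      rw [map_mul, hE, hEinv]
      exact div_mem_blowupAlgebra _ _ (Ideal.mem_map_of_mem _ hx₀)
    · rw [hE]
      exact Subalgebra.algebraMap_mem _ _
    · rw [map_add]
      exact add_mem hy hz
    · rw [map_mul]
      exact mul_mem hy hz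
  -- `E⁻¹` maps `R'[e(I)/e(a)]` into `R[I/a]`
  have hbwd : ∀ y ∈ blowupAlgebra (I.map (e : R →+* R')) (e a), E.symm y ∈ blowupAlgebra I a := by
    intro y hy
    refine Algebra.adjoin_induction (fun z hz => ?_) (fun r => ?_) (fun y z _ _ hy hz => ?_)
      (fun y z _ _ hy hz => ?_) hy
    · obtain ⟨y₀, hy₀, rfl⟩ := hz
      rw [map_mul, hEsymm, hEinv']
      refine div_mem_blowupAlgebra _ _ ?_
      obtain ⟨x₀, hx₀, rfl⟩ := (Ideal.mem_map_of_equiv e y₀).mp hy₀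
      rwa [e.symm_apply_apply]
    · rw [hEsymm]
      exact Subalgebra.algebraMap_mem _ _
    · rw [map_add]
      exact add_mem hy hz
    · rw [map_mul]
      exact mul_mem hy hz
  refine ⟨{ toFun := fun x => ⟨E x, hfwd x x.2⟩
            invFun := fun y => ⟨E.symm y, hbwd y y.2⟩
            left_inv := fun x => Subtype.ext (E.symm_apply_apply _)
            right_inv := fun y => Subtype.ext (E.apply_symm_apply _)
            map_mul' := fun x y => Subtype.ext (by
              change E ((x : Localization.Away a) * y) = E x * E y
              exact map_mul E _ _)
            map_add' := fun x y => Subtype.ext (by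
              change E ((x : Localization.Away a) + y) = E x + E y
              exact map_add E _ _) }, fun r => Subtype.ext ?_⟩
  change E (algebraMap R (Localization.Away a) r) = algebraMap R' (Localization.Away (e a)) (e r)
  exact hE r

/-- **Regularity of the affine blowup algebra is transported along ring isomorphisms**
(`f = e` as functions, stated for an arbitrary presentation `f` of the isomorphism). [folklore] -/
theorem isRegularRing_blowupAlgebra_map_of_ringEquiv (e : R ≃+* R') (f : R →+* R')
    (hf : ∀ x, f x = e x) (I : Ideal R) (a : R) (h : IsRegularRing (blowupAlgebra I a)) :
    IsRegularRing (blowupAlgebra (I.map f) (f a)) := by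
  have hfe : f = (e : R →+* R') := RingHom.ext hf
  subst hfe
  obtain ⟨F, -⟩ := exists_blowupAlgebra_ringEquiv_of_ringEquiv e I a
  haveI := h
  exact IsRegularRing.of_ringEquiv F

end BlowupExit

namespace ToricExit

/-- **The affine blowup algebra of the chart `V[⊤, x_b²]` is a regular ring**:
`Γ(𝔸ⁿ, ⊤)[Ĩ₂(⊤)/x_b²] ≅ k[x][I₂/x_b²] ≅ (k[x][I₂t])_{(x_b²t)}` (`ΓSpecIso`, `reesChartEquiv`) and
the last ring is regular (`ToricExit.isRegularRing_chartRing_centre_b`, p485686). [OURS · L1 W4.5c]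
[folklore; assembly of landed decls] -/
theorem isRegularRing_blowupAlgebra_idealSheaf_centre_b (k : Type) [Field k] (n : ℕ)
    (a b : Fin n) (hab : a ≠ b) :
    IsRegularRing (blowupAlgebra
      ((affineBlowup.idealSheaf (Ideal.span (Set.range (![X a, X b ^ 2] :
        Fin 2 → MvPolynomial (Fin n) k)))).ideal ⟨⊤, isAffineOpen_top _⟩)
      ((Scheme.ΓSpecIso (CommRingCat.of (MvPolynomial (Fin n) k))).inv.hom (X b ^ 2))) := by
  -- the Rees chart ring `(k[x][I₂t])_{(x_b²t)}` is regular (D2) ...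
  have hxb : (X b ^ 2 : MvPolynomial (Fin n) k) ∈
      Ideal.span (Set.range (![X a, X b ^ 2] : Fin 2 → MvPolynomial (Fin n) k)) :=
    Ideal.subset_span ⟨1, rfl⟩
  haveI : IsRegularRing (Away (reesGrading (Ideal.span (Set.range (![X a, X b ^ 2] :
      Fin 2 → MvPolynomial (Fin n) k)))) (reesT (X b ^ 2 : MvPolynomial (Fin n) k) hxb)) :=
    isRegularRing_chartRing_centre_b k n a b hab
  -- ... hence so is `k[x][I₂/x_b²]` (`reesChartEquiv`) ...
  have h1 : IsRegularRing (blowupAlgebra (Ideal.span (Set.range (![X a, X b ^ 2] :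
      Fin 2 → MvPolynomial (Fin n) k))) (X b ^ 2 : MvPolynomial (Fin n) k)) :=
    IsRegularRing.of_ringEquiv (R := Away (reesGrading (Ideal.span (Set.range (![X a, X b ^ 2] :
      Fin 2 → MvPolynomial (Fin n) k)))) (reesT (X b ^ 2 : MvPolynomial (Fin n) k) hxb))
      (reesChartEquiv (X b ^ 2 : MvPolynomial (Fin n) k) hxb)
  -- ... and its transport along `Γ(Spec k[x], ⊤) ≅ k[x]`
  have h2 := BlowupExit.isRegularRing_blowupAlgebra_map_of_ringEquiv
    (Scheme.ΓSpecIso (CommRingCat.of (MvPolynomial (Fin n) k))).commRingCatIsoToRingEquiv.symm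
    (Scheme.ΓSpecIso (CommRingCat.of (MvPolynomial (Fin n) k))).inv.hom (fun _ => rfl)
    (Ideal.span (Set.range (![X a, X b ^ 2] : Fin 2 → MvPolynomial (Fin n) k))) (X b ^ 2) h1
  have hIdeal : (affineBlowup.idealSheaf (Ideal.span (Set.range (![X a, X b ^ 2] :
      Fin 2 → MvPolynomial (Fin n) k)))).ideal ⟨⊤, isAffineOpen_top _⟩ =
      (Ideal.span (Set.range (![X a, X b ^ 2] : Fin 2 → MvPolynomial (Fin n) k))).map
        (Scheme.ΓSpecIso (CommRingCat.of (MvPolynomial (Fin n) k))).inv.hom := by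
    change (Scheme.IdealSheafData.ofIdealTop _).ideal ⟨⊤, isAffineOpen_top _⟩ = _
    rw [ideal_ofIdealTop_top]
  rw [hIdeal]
  exact h2

/-- **Brick `Hregb` of the J₃ toric exit** (hypothesis `Hregb` of
`ToricExit.jordanThree_hasResolution_of_bricks`, p496627, literally): every point of the principal
chart `V[⊤, x_b²]` of `V = Bl_{(x_a,x_b²)} 𝔸ⁿ` has a regular local ring (the chart is affine with
regular coordinate ring, `BlowupExit.isRegular_blowupChart_of_isRegularRing`, p492566).
[OURS · L1 W4.5c] [folklore; assembly of landed decls] -/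
theorem isRegularLocalRing_stalk_of_mem_blowupChart_centre_b (k : Type) [Field k] (n : ℕ)
    (a b : Fin n) (hab : a ≠ b)
    (v : affineBlowup (Ideal.span (Set.range (![X a, X b ^ 2] :
      Fin 2 → MvPolynomial (Fin n) k))))
    (hv : v ∈ blowupChart
      (affineBlowup.π (Ideal.span (Set.range (![X a, X b ^ 2] : Fin 2 → MvPolynomial (Fin n) k))))
      (affineBlowup.idealSheaf (Ideal.span (Set.range (![X a, X b ^ 2] :
        Fin 2 → MvPolynomial (Fin n) k))))
      ⟨⊤, isAffineOpen_top _⟩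
      ((Scheme.ΓSpecIso (CommRingCat.of (MvPolynomial (Fin n) k))).inv.hom (X b ^ 2))) :
    IsRegularLocalRing ((affineBlowup (Ideal.span (Set.range (![X a, X b ^ 2] :
      Fin 2 → MvPolynomial (Fin n) k)))).presheaf.stalk v) := by
  have hIdeal : (affineBlowup.idealSheaf (Ideal.span (Set.range (![X a, X b ^ 2] :
      Fin 2 → MvPolynomial (Fin n) k)))).ideal ⟨⊤, isAffineOpen_top _⟩ =
      (Ideal.span (Set.range (![X a, X b ^ 2] : Fin 2 → MvPolynomial (Fin n) k))).map
        (Scheme.ΓSpecIso (CommRingCat.of (MvPolynomial (Fin n) k))).inv.hom := by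
    change (Scheme.IdealSheafData.ofIdealTop _).ideal ⟨⊤, isAffineOpen_top _⟩ = _
    rw [ideal_ofIdealTop_top]
  have hxb : (Scheme.ΓSpecIso (CommRingCat.of (MvPolynomial (Fin n) k))).inv.hom (X b ^ 2) ∈
      (affineBlowup.idealSheaf (Ideal.span (Set.range (![X a, X b ^ 2] :
        Fin 2 → MvPolynomial (Fin n) k)))).ideal ⟨⊤, isAffineOpen_top _⟩ := by
    rw [hIdeal]
    exact Ideal.mem_map_of_mem _ (Ideal.subset_span ⟨1, rfl⟩)
  exact BlowupExit.isRegularLocalRing_stalk_of_mem _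
    (BlowupExit.isRegular_blowupChart_of_isRegularRing (affineBlowup.isBlowup _)
      ⟨⊤, isAffineOpen_top _⟩ hxb (isRegularRing_blowupAlgebra_idealSheaf_centre_b k n a b hab))
    v hv

end ToricExit

end Summit.ResolutionOfSingularities.ResolutionOfSingularities.Theorems.WildQuotientResolution

end
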